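import Mathlib

/-!
# Kernel certificate: the Galois orbit of the Kuga–Satake spin weights of a D₄ K-line is the reflex type — Theorem 1 (c) of
P2-D4TripleReading v1 on the abstract D₄ configuration (seat p2 (g5), pub-hodge-repro0).

`D₄ = ⟨r, s⟩` acts on the four embeddings `c₀, c₁, c₂, c₃` of the non-Galois quartic CM field `K = F^⟨s⟩` (the cosets `r^i⟨s⟩`):
`r = (c₀ c₁ c₂ c₃)`, `s = (c₁ c₃)`, `ι = r²` the complex conjugation (`c₀ ↔ c₂`, `c₁ ↔ c₃`). The character lattice of the norm-one torus
`T₁ = U(1)_{K/K₀}` has the basis `ε₁ = ε_{c₀}`, `ε₂ = ε_{c₁}` with `ε_{c₂} = −ε₁`, `ε_{c₃} = −ε₂`, and `g · ε_{c_i} = ε_{g c_i}`;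
the weights of the K-line `V` are `±ε₁, ±ε₂`, the half-spin weights `±½(ε₁ + ε₂), ±½(ε₁ − ε₂)` — doubled here to stay integral:
`σ₊ = (1, 1)`, `σ₋ = (1, −1)`. Certified by `decide`:
* `group_D4`: the eight listed permutations form a group containing `r`, `s`, `ι = r²`;
* `spin_orbit`: the D₄-orbit of `σ₊` is exactly `{σ₊, −σ₋, −σ₊, σ₋}` — all four spin weights, ONE orbit;
* `spin_stabiliser`: the stabiliser of `σ₊` is `{1, rs}` = `⟨rs⟩` = `Gal(F/K*)`, so the field of the spin weights is `K* = F^⟨rs⟩`;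
* `reflex_type`: the two spin weights of Hodge type `(1,0)`, `σ₊ = 1·σ₊` and `σ₋ = s·σ₊`, correspond to the cosets `⟨rs⟩` and `s⟨rs⟩` of
  `⟨rs⟩` in `D₄`, and this set of cosets is the REFLEX TYPE `Φ* = {g⁻¹⟨rs⟩ : g ∈ Φ̃}`, `Φ̃ = {g : g·c₀ ∈ Φ}`, of the type `Φ = {c₀, c₁}`
  — «the reflex field of `K` is the field of the half-spin weights of `V`, and the reflex type is their `(1,0)`-half».
-/

namespace HodgeRepro0.P2D4SpinWeights

/-- a permutation of `0..3` given as the list of its values -/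
def ap (t : List Nat) (x : Nat) : Nat := t.getD x x

/-- composition `s ∘ t` -/
def comp (s t : List Nat) : List Nat := t.map (ap s)

/-- the inverse permutation -/
def inv (t : List Nat) : List Nat := (List.range 4).map (fun y => ((List.range 4).filter (fun x => ap t x == y)).headD 0)

/-- the list is closed under composition -/
def closed (G : List (List Nat)) : Bool := G.all (fun a => G.all (fun b => G.elem (comp a b)))

/-- the weight `ε_{c_i}` in the basis `ε₁, ε₂` -/
def eps (i : Nat) : Int × Int := if i == 0 then (1, 0) else if i == 1 then (0, 1) else if i == 2 then (-1, 0) else (0, -1)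

/-- the action of `g` on a weight `a ε₁ + b ε₂`: `g · (a ε₁ + b ε₂) = a ε_{g c₀} + b ε_{g c₁}` -/
def actW (g : List Nat) (w : Int × Int) : Int × Int :=
  ((eps (ap g 0)).1 * w.1 + (eps (ap g 1)).1 * w.2, (eps (ap g 0)).2 * w.1 + (eps (ap g 1)).2 * w.2)

/-- the canonical list of a set of weights -/
def canonW (L : List (Int × Int)) : List (Int × Int) :=
  [(1, 1), (1, -1), (-1, 1), (-1, -1), (1, 0), (0, 1), (-1, 0), (0, -1)].filter (fun w => L.elem w)

/-- the rotation `r = (c₀ c₁ c₂ c₃)` -/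
def r : List Nat := [1, 2, 3, 0]

/-- the reflection `s = (c₁ c₃)` (fixing `c₀`, `c₂`): `K = F^⟨s⟩` -/
def s : List Nat := [0, 3, 2, 1]

/-- the identity -/
def e : List Nat := [0, 1, 2, 3]

/-- `D₄` as the eight permutations `e, r, r², r³, s, rs, r²s, r³s` -/
def D4 : List (List Nat) :=
  [e, r, comp r r, comp r (comp r r), s, comp r s, comp r (comp r s), comp r (comp r (comp r s))]

/-- the coset `g⟨rs⟩` as a canonical list of its two elements -/
def cosetRS (g : List Nat) : List (List Nat) := D4.filter (fun h => h == g || h == comp g (comp r s))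

/-- the eight listed permutations form a group containing `r`, `s` and `ι = r²`; `rs` has order 2 -/
theorem group_D4 : closed D4 = true ∧ D4.length = 8 ∧ D4.eraseDups.length = 8 ∧ D4.elem r = true ∧ D4.elem s = true ∧
    D4.elem (comp r r) = true ∧ comp (comp r s) (comp r s) = e := by decide

/-- the orbit of the spin weight `σ₊ = ½(ε₁ + ε₂)` (doubled: `(1,1)`) is all four spin weights -/
theorem spin_orbit : canonW (D4.map (fun g => actW g (1, 1))) = [(1, 1), (1, -1), (-1, 1), (-1, -1)] := by decide

/-- the stabiliser of `σ₊` is `{e, rs}` -/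
theorem spin_stabiliser : D4.filter (fun g => actW g (1, 1) == (1, 1)) = [e, comp r s] := by decide

/-- the `(1,0)`-spin weights `{σ₊, σ₋}` are `{1·σ₊, s·σ₊}`; the cosets `⟨rs⟩`, `s⟨rs⟩` are the reflex type of `Φ = {c₀, c₁}`:
`Φ̃ = {g : g·c₀ ∈ Φ}` and `{g⁻¹⟨rs⟩ : g ∈ Φ̃}` = `{⟨rs⟩, s⟨rs⟩}`, while every other coset moves `σ₊` to a `(0,1)`-weight -/
theorem reflex_type :
    actW e (1, 1) = (1, 1) ∧ actW s (1, 1) = (1, -1) ∧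
    (D4.filter (fun g => [0, 1].elem (ap g 0))) = [e, r, s, comp r s] ∧
    ((D4.filter (fun g => [0, 1].elem (ap g 0))).map (fun g => cosetRS (inv g))).eraseDups = [cosetRS e, cosetRS s] ∧
    ((D4.filter (fun g => [(1, 1), (1, -1)].elem (actW g (1, 1)))).map cosetRS).eraseDups = [cosetRS e, cosetRS s] ∧
    cosetRS e = [e, comp r s] ∧ cosetRS s = [comp r (comp r r), s] := by decide

end HodgeRepro0.P2D4SpinWeights
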